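import Summits.MatrixMultiplication.MatrixMultiplication.Theorems.ObstructionCalculusInvariants
import Summits.MatrixMultiplication.MatrixMultiplication.Theses.ObstructionDescent

set_option linter.dupNamespace false

/-!
# The unit-tensor orbit ideal is prime — the semigroup engine (decomp-mm · lens 3 · gen 10; landing v2)

Route `route-MatrixMultiplication-ObstructionDescent` (sub-problem `MatrixMultiplication`, `ω(ℂ) = 2`), rev 6 `ab442fba73aa`.
This module closes the aside **`UnitOrbitIdealPrime`** (item `stmt-MatrixMultiplication-32149`) BY NAME.  It imports the
LANDED obstruction calculus (`Theorems/ObstructionCalculusAction.lean` → `Theorems/ObstructionCalculusInvariants.lean`: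
`fromCols`, `actTensor_unitTensor`, `evalT`, `orbitVanishing`, `hwvSpace`, `weightChar`, `genMat`/`matOf`, the density
argument `evalT_fromCols_eq_zero_of_generic`) instead of restating it (v1 of this file carried a copy; dedup), and adds:

* §1 `weightChar_add`, `mul_mem_hwvSpace` (weight vectors multiply: types form a monoid), `one_mem_hwvSpace_zero`;
* §2 the generic point `genPoint` of `Mat_m³·⟨m⟩` and **`mem_orbitVanishing_unitTensor_iff`**:
  `I(GL_m³·⟨m⟩) = ker (f ↦ f[A|B|C])`, the kernel of a ring map into a domain; hence
  **`mul_mem_orbitVanishing_unitTensor_iff`** (`f·g ∈ I ⟺ f ∈ I ∨ g ∈ I`: the ideal is PRIME, i.e. the orbit closure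
  `σ_m` is irreducible), `one_not_mem_orbitVanishing_unitTensor`, and the SEMIGROUP ENGINE
  `not_hwvSpace_add_le_orbitVanishing_unitTensor` / `…_sum_…` (occurring types of `ℂ[σ_m]` add; Bürgisser–Ikenmeyer 2011,
  Lemma 3.2);
* §3 `unitOrbitIdealPrime_holds : Theses.ObstructionDescent.UnitOrbitIdealPrime` (the route item, verbatim type).

All statements are over `ℂ`; no `sorry`; standard axioms.  Source: the gen-10 kernel `SemigroupEngine_g10_tree.lean`
(sha256 `1328ead0…384e`, Part 8 §8.1–8.3, byte-identical bodies).
[cite: BurgisserIkenmeyer2011, Lemma 3.2 and §3.1; BurgisserIkenmeyer2017, §5]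
-/

noncomputable section

open scoped BigOperators
open Finset



namespace Summit.MatrixMultiplication.MatrixMultiplication.Theorems.ObstructionCalculus

open Literature.Computability.AlgebraicComplexity (tensorRank matMulTensor unitTensor actTensor)

section SemigroupEngine

variable {m : ℕ}

/-! ### 8.1 Types multiply -/

/-- `weightChar` is additive in the exponent vector. [bookkeeping] -/
theorem weightChar_add (l₁ l₂ : Fin m → ℕ) (A : Matrix (Fin m) (Fin m) ℂ) :
    weightChar (l₁ + l₂) A = weightChar l₁ A * weightChar l₂ A := by
  simp only [weightChar, Pi.add_apply, pow_add, Finset.prod_mul_distrib]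

/-- **Weight vectors multiply** (the type monoid): `W_{Λ₁,d₁} · W_{Λ₂,d₂} ⊆ W_{Λ₁+Λ₂,d₁+d₂}`.
[cite: BurgisserIkenmeyer2011, Lemma 3.2 (semigroup property)] -/
theorem mul_mem_hwvSpace {Λ₁ Λ₂ : Fin 3 → Fin m → ℕ} {d₁ d₂ : ℕ} {f g : MvPolynomial (Idx m) ℂ}
    (hf : f ∈ hwvSpace Λ₁ d₁) (hg : g ∈ hwvSpace Λ₂ d₂) :
    f * g ∈ hwvSpace (Λ₁ + Λ₂) (d₁ + d₂) := by
  refine ⟨hf.1.mul hg.1, fun A B C hA hB hC t => ?_⟩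
  rw [map_mul, map_mul, hf.2 A B C hA hB hC t, hg.2 A B C hA hB hC t, Pi.add_apply, Pi.add_apply,
    Pi.add_apply, weightChar_add, weightChar_add, weightChar_add]
  ring

/-- `1` is a weight vector of type `0` in degree `0`. [bookkeeping] -/
theorem one_mem_hwvSpace_zero : (1 : MvPolynomial (Idx m) ℂ) ∈ hwvSpace (0 : Fin 3 → Fin m → ℕ) 0 := by
  refine ⟨MvPolynomial.isHomogeneous_one _ _, fun A B C _ _ _ t => ?_⟩
  simp [weightChar]

/-! ### 8.2 `I(GL_m³·⟨m⟩)` is a prime ideal: the kernel of the generic substitution -/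

variable (m) in
/-- The generic point `[A|B|C]` of `Mat_m³·⟨m⟩`, with coordinates in the polynomial ring of matrix entries. [bookkeeping] -/
def genPoint : Idx m → MvPolynomial (MIdx m) ℂ :=
  fun p => fromCols (genMat 0) (genMat 1) (genMat 2) p.1 p.2.1 p.2.2

/-- Evaluating the generic substitution at matrix entries `e` is evaluating at `[A|B|C]` for the encoded matrices.
[bookkeeping] -/
theorem aeval_bind₁_genPoint (e : MIdx m → ℂ) (f : MvPolynomial (Idx m) ℂ) :
    MvPolynomial.aeval e (MvPolynomial.bind₁ (genPoint m) f) =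
      evalT (fromCols (matOf e 0) (matOf e 1) (matOf e 2)) f := by
  have hfun : (fun p : Idx m => MvPolynomial.aeval e (genPoint m p)) =
      fun p : Idx m => fromCols (matOf e 0) (matOf e 1) (matOf e 2) p.1 p.2.1 p.2.2 :=
    funext fun p => aeval_fromCols_genMat e p.1 p.2.1 p.2.2
  rw [MvPolynomial.aeval_bind₁, hfun]
  rfl

/-- **`I(GL_m³·⟨m⟩) = ker (x ↦ [A|B|C])`.**  A polynomial vanishes on the orbit `GL_m³·⟨m⟩` iff its pull-back to the
generic matrices `A, B, C` is the zero polynomial (density of invertible triples, Part 1).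
[cite: BurgisserIkenmeyer2011, §3.1; this node] -/
theorem mem_orbitVanishing_unitTensor_iff (f : MvPolynomial (Idx m) ℂ) :
    f ∈ orbitVanishing (unitTensor ℂ m) ↔ MvPolynomial.bind₁ (genPoint m) f = 0 := by
  constructor
  · intro hf
    have hall : ∀ A B C : Matrix (Fin m) (Fin m) ℂ, evalT (fromCols A B C) f = 0 := by
      refine evalT_fromCols_eq_zero_of_generic f fun A B C hA hB hC => ?_
      have h := hf A B C hA hB hC
      rwa [actTensor_unitTensor] at h
    apply MvPolynomial.funext
    intro e
    rw [map_zero]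
    change MvPolynomial.aeval e (MvPolynomial.bind₁ (genPoint m) f) = 0
    rw [aeval_bind₁_genPoint]
    exact hall _ _ _
  · intro h A B C _ _ _
    obtain ⟨e, he0, he1, he2⟩ := matOf_entries A B C
    rw [actTensor_unitTensor, ← he0, ← he1, ← he2, ← aeval_bind₁_genPoint, h, map_zero]

/-- **`I(GL_m³·⟨m⟩)` is prime** (the orbit closure `σ_m` is irreducible): `f·g` vanishes on the orbit iff `f` or `g` does.
[cite: BurgisserIkenmeyer2011, Lemma 3.2; this node] -/
theorem mul_mem_orbitVanishing_unitTensor_iff {f g : MvPolynomial (Idx m) ℂ} :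
    f * g ∈ orbitVanishing (unitTensor ℂ m) ↔
      f ∈ orbitVanishing (unitTensor ℂ m) ∨ g ∈ orbitVanishing (unitTensor ℂ m) := by
  simp only [mem_orbitVanishing_unitTensor_iff, map_mul, mul_eq_zero]

/-- `1 ∉ I(GL_m³·⟨m⟩)`. [bookkeeping] -/
theorem one_not_mem_orbitVanishing_unitTensor :
    (1 : MvPolynomial (Idx m) ℂ) ∉ orbitVanishing (unitTensor ℂ m) := by
  rw [mem_orbitVanishing_unitTensor_iff, map_one]
  exact one_ne_zero

/-! ### 8.3 The engine: occurring types of `ℂ[σ_m]` form a semigroup -/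

/-- **Semigroup engine.** If neither `W_{Λ₁,d₁}` nor `W_{Λ₂,d₂}` lies in `I(σ_m)` (both types OCCUR in `ℂ[σ_m]`), then
`W_{Λ₁+Λ₂,d₁+d₂}` does not lie in `I(σ_m)` either. [cite: BurgisserIkenmeyer2011, Lemma 3.2; this node] -/
theorem not_hwvSpace_add_le_orbitVanishing_unitTensor {Λ₁ Λ₂ : Fin 3 → Fin m → ℕ} {d₁ d₂ : ℕ}
    (h₁ : ¬ hwvSpace Λ₁ d₁ ≤ orbitVanishing (unitTensor ℂ m))
    (h₂ : ¬ hwvSpace Λ₂ d₂ ≤ orbitVanishing (unitTensor ℂ m)) :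
    ¬ hwvSpace (Λ₁ + Λ₂) (d₁ + d₂) ≤ orbitVanishing (unitTensor ℂ m) := by
  intro h
  obtain ⟨f, hf, hfU⟩ := SetLike.not_le_iff_exists.1 h₁
  obtain ⟨g, hg, hgU⟩ := SetLike.not_le_iff_exists.1 h₂
  rcases mul_mem_orbitVanishing_unitTensor_iff.1 (h (mul_mem_hwvSpace hf hg)) with h' | h'
  exacts [hfU h', hgU h']

/-- **Semigroup engine, finite sums.** [this node] -/
theorem not_hwvSpace_sum_le_orbitVanishing_unitTensor {ι : Type*} (s : Finset ι)
    (Λs : ι → Fin 3 → Fin m → ℕ) (ds : ι → ℕ)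
    (h : ∀ i ∈ s, ¬ hwvSpace (Λs i) (ds i) ≤ orbitVanishing (unitTensor ℂ m)) :
    ¬ hwvSpace (∑ i ∈ s, Λs i) (∑ i ∈ s, ds i) ≤ orbitVanishing (unitTensor ℂ m) := by
  classical
  induction s using Finset.induction_on with
  | empty =>
    rw [Finset.sum_empty, Finset.sum_empty]
    exact fun hle => one_not_mem_orbitVanishing_unitTensor (hle one_mem_hwvSpace_zero)
  | @insert i s hi ih =>
    rw [Finset.sum_insert hi, Finset.sum_insert hi]
    exact not_hwvSpace_add_le_orbitVanishing_unitTensor (h i (Finset.mem_insert_self i s))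
      (ih fun j hj => h j (Finset.mem_insert_of_mem hj))

end SemigroupEngine

end Summit.MatrixMultiplication.MatrixMultiplication.Theorems.ObstructionCalculus

/-! ## §3 The route item, by name -/

namespace Summit.MatrixMultiplication.MatrixMultiplication.Theses.ObstructionDescent

/-- **item `stmt-MatrixMultiplication-32149` `UnitOrbitIdealPrime`** (aside, rank 9): for every `m`, a product
`f·g` vanishes on the orbit `GL_m³·⟨m⟩` iff `f` or `g` does.  PROVED.
[cite: BurgisserIkenmeyer2011, Lemma 3.2] -/
theorem unitOrbitIdealPrime_holds : UnitOrbitIdealPrime :=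
  fun _ _ _ => Theorems.ObstructionCalculus.mul_mem_orbitVanishing_unitTensor_iff

end Summit.MatrixMultiplication.MatrixMultiplication.Theses.ObstructionDescent
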